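import Mathlib
import Summits.Schanuel.Schanuel.Theorems.AclSubsetLogFreeCore.Negative.CoreAutWild

/-!
# Crux `AclSubsetLogFreeCore` — equivalent forms of the residue stub `stub_coreFixedField_logFree`

Drefute (gen 2) service lemmas for the planner's promote-stub of the residue (A₀) of line
`eac-extends-core-automorphisms` (crux stmt-Schanuel-0968).  With `C₀ := ecl ∅`, `C_EA := logFreeCore` and
"core automorphism" = any `g : ℂ → ℂ` with `IsEIsoOn g (ecl ∅) (ecl ∅)`, the following are EQUIVALENT
(kernel-checked, unconditional):

* (i)   as filed: every `a ∈ C₀` fixed by all core automorphisms lies in `C_EA`;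
* (iii) the `A⁺`-form: every `a ∈ C₀` fixed by all core automorphisms FIXING `2πi` lies in `C_EA`
        (`coreFixedFieldLogFree_iff_plus`; `conj` normalises the index-two subgroup `A⁺`, which fixes `i`);
* (v)   the moving form: every REAL `x ∈ C₀ ∖ C_EA` is moved by some core automorphism
        (`coreFixedFieldLogFree_iff_real_moved`) — the honest name of the task: construct automorphisms of
        the field of exponentially algebraic numbers (cf. `CoreAutWild`: such automorphisms are necessarily wild).

((ii), the restriction of (i) to real `a`, is `CoreAutConj.coreFixedFieldLogFree_iff_real`.)  Also recorded:
core automorphisms compose (`coreAut_comp`) and are `conj`-conjugable (`coreAut_conj_comp_conj`).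
-/

noncomputable section

set_option linter.dupNamespace false

open Literature.ModelTheory.ExponentialFields Literature.NumberTheory.Transcendental

namespace Summit.Schanuel.Schanuel.Theorems.AclSubsetLogFreeCore.Negative

section CoreAut

variable {g g' : ℂ → ℂ}

/-- Core automorphisms compose. -/
theorem coreAut_comp (hg : IsEIsoOn g (ecl (∅ : Set ℂ)) (ecl (∅ : Set ℂ)))
    (hg' : IsEIsoOn g' (ecl (∅ : Set ℂ)) (ecl (∅ : Set ℂ))) :
    IsEIsoOn (g ∘ g') (ecl (∅ : Set ℂ)) (ecl (∅ : Set ℂ)) where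
  bijOn := hg.bijOn.comp hg'.bijOn
  map_add := fun u v hu hv => by
    simp only [Function.comp_apply]
    rw [hg'.map_add hu hv, hg.map_add (hg'.bijOn.mapsTo hu) (hg'.bijOn.mapsTo hv)]
  map_mul := fun u v hu hv => by
    simp only [Function.comp_apply]
    rw [hg'.map_mul hu hv, hg.map_mul (hg'.bijOn.mapsTo hu) (hg'.bijOn.mapsTo hv)]
  map_exp := fun u hu => by
    simp only [Function.comp_apply]
    rw [hg'.map_exp hu, hg.map_exp (hg'.bijOn.mapsTo hu)]

/-- `conj ∘ g ∘ conj` is a core automorphism. -/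
theorem coreAut_conj_comp_conj (hg : IsEIsoOn g (ecl (∅ : Set ℂ)) (ecl (∅ : Set ℂ))) :
    IsEIsoOn (starRingEnd ℂ ∘ g ∘ starRingEnd ℂ) (ecl (∅ : Set ℂ)) (ecl (∅ : Set ℂ)) :=
  coreAut_comp isEIsoOn_conj_ecl_empty (coreAut_comp hg isEIsoOn_conj_ecl_empty)

/-- `conj (2πi) = -2πi`. -/
theorem conj_two_pi_I : (starRingEnd ℂ) (2 * (Real.pi : ℂ) * Complex.I) = -(2 * (Real.pi : ℂ) * Complex.I) := by
  apply Complex.ext <;> simp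

/-- A map with `g (2πi) = -2πi` fixes `2πi` after composing with `conj`. -/
theorem conj_comp_map_two_pi_I
    (h2 : g (2 * (Real.pi : ℂ) * Complex.I) = -(2 * (Real.pi : ℂ) * Complex.I)) :
    (starRingEnd ℂ ∘ g) (2 * (Real.pi : ℂ) * Complex.I) = 2 * (Real.pi : ℂ) * Complex.I := by
  simp only [Function.comp_apply, h2, map_neg, conj_two_pi_I, neg_neg]

/-- A core automorphism fixing `2πi` fixes `i`. -/
theorem coreAut_map_I_of_map_two_pi_I (hg : IsEIsoOn g (ecl (∅ : Set ℂ)) (ecl (∅ : Set ℂ)))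
    (h2 : g (2 * (Real.pi : ℂ) * Complex.I) = 2 * (Real.pi : ℂ) * Complex.I) :
    g Complex.I = Complex.I := by
  rcases coreAut_map_two_pi_I_and_map_I hg with ⟨-, hI⟩ | ⟨h2', -⟩
  · exact hI
  · exfalso
    rw [h2] at h2'
    have : (2 * (Real.pi : ℂ) * Complex.I) = 0 := by linear_combination h2' / 2
    exact two_pi_I_ne_zero' this

end CoreAut

/-- **(i) ⟺ (iii)**: the residue stub is equivalent to its `A⁺`-form, where only core automorphisms
FIXING `2πi` are asked to fix `a`. -/
theorem coreFixedFieldLogFree_iff_plus :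
    (∀ a ∈ ecl (∅ : Set ℂ),
      (∀ g : ℂ → ℂ, IsEIsoOn g (ecl (∅ : Set ℂ)) (ecl (∅ : Set ℂ)) → g a = a) →
        a ∈ (logFreeCore : Set ℂ)) ↔
    (∀ a ∈ ecl (∅ : Set ℂ),
      (∀ g : ℂ → ℂ, IsEIsoOn g (ecl (∅ : Set ℂ)) (ecl (∅ : Set ℂ)) →
        g (2 * (Real.pi : ℂ) * Complex.I) = 2 * (Real.pi : ℂ) * Complex.I → g a = a) →
        a ∈ (logFreeCore : Set ℂ)) := by
  refine ⟨fun h a ha hfix => ?_, fun h a ha hfix => h a ha fun g hg _ => hfix g hg⟩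
  have htmem : (2 * (Real.pi : ℂ) * Complex.I) ∈ ecl (∅ : Set ℂ) := two_pi_I_mem_ecl_empty
  -- `conj a` is `A⁺`-fixed as well
  have hca : ∀ g : ℂ → ℂ, IsEIsoOn g (ecl (∅ : Set ℂ)) (ecl (∅ : Set ℂ)) →
      g (2 * (Real.pi : ℂ) * Complex.I) = 2 * (Real.pi : ℂ) * Complex.I →
        g ((starRingEnd ℂ) a) = (starRingEnd ℂ) a := by
    intro g hg h2
    have hg' := coreAut_conj_comp_conj hg
    have h2' : (starRingEnd ℂ ∘ g ∘ starRingEnd ℂ) (2 * (Real.pi : ℂ) * Complex.I) =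
        2 * (Real.pi : ℂ) * Complex.I := by
      simp only [Function.comp_apply, conj_two_pi_I, hg.map_neg htmem, h2, map_neg, neg_neg]
    have h3 := hfix _ hg' h2'
    simp only [Function.comp_apply] at h3
    have h4 := congrArg (starRingEnd ℂ) h3
    rwa [Complex.conj_conj] at h4
  -- hence `Re a` and `Im a` are `A⁺`-fixed
  have hre : ∀ g : ℂ → ℂ, IsEIsoOn g (ecl (∅ : Set ℂ)) (ecl (∅ : Set ℂ)) →
      g (2 * (Real.pi : ℂ) * Complex.I) = 2 * (Real.pi : ℂ) * Complex.I →
        g ((a.re : ℝ) : ℂ) = ((a.re : ℝ) : ℂ) := by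
    intro g hg h2
    have hr : ((a.re : ℝ) : ℂ) = ((1 / 2 : ℚ) : ℂ) * (a + (starRingEnd ℂ) a) := by
      rw [Complex.add_conj]; push_cast; ring
    rw [hr, coreAut_map_ratCast_mul hg _ (Khovanskii.add_mem_ecl ha (conj_mem_ecl_empty ha)),
      hg.map_add ha (conj_mem_ecl_empty ha), hfix g hg h2, hca g hg h2]
  have him : ∀ g : ℂ → ℂ, IsEIsoOn g (ecl (∅ : Set ℂ)) (ecl (∅ : Set ℂ)) →
      g (2 * (Real.pi : ℂ) * Complex.I) = 2 * (Real.pi : ℂ) * Complex.I →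
        g ((a.im : ℝ) : ℂ) = ((a.im : ℝ) : ℂ) := by
    intro g hg h2
    have hi : ((a.im : ℝ) : ℂ) = ((-1 / 2 : ℚ) : ℂ) * Complex.I * (a - (starRingEnd ℂ) a) := by
      rw [Complex.sub_conj]; push_cast
      linear_combination ((a.im : ℝ) : ℂ) * Complex.I_mul_I
    have hsub : a - (starRingEnd ℂ) a ∈ ecl (∅ : Set ℂ) := sub_mem_ecl_empty ha (conj_mem_ecl_empty ha)
    rw [hi, hg.map_mul (Khovanskii.mul_mem_ecl (ratCast_mem_ecl_empty _) I_mem_ecl_empty) hsub,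
      coreAut_map_ratCast_mul hg _ I_mem_ecl_empty, coreAut_map_I_of_map_two_pi_I hg h2,
      sub_eq_add_neg, hg.map_add ha (Khovanskii.neg_mem_ecl (conj_mem_ecl_empty ha)),
      hg.map_neg (conj_mem_ecl_empty ha), hfix g hg h2, hca g hg h2]
  -- and then fixed by ALL core automorphisms (compose with `conj` when `g (2πi) = -2πi`)
  have hupgrade : ∀ x : ℝ, (x : ℂ) ∈ ecl (∅ : Set ℂ) →
      (∀ g : ℂ → ℂ, IsEIsoOn g (ecl (∅ : Set ℂ)) (ecl (∅ : Set ℂ)) →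
        g (2 * (Real.pi : ℂ) * Complex.I) = 2 * (Real.pi : ℂ) * Complex.I → g x = x) →
      ∀ g : ℂ → ℂ, IsEIsoOn g (ecl (∅ : Set ℂ)) (ecl (∅ : Set ℂ)) → g x = x := by
    intro x _ hx g hg
    rcases coreAut_map_two_pi_I hg with h2 | h2
    · exact hx g hg h2
    · have hcg := coreAut_comp isEIsoOn_conj_ecl_empty hg
      have h3 := hx _ hcg (conj_comp_map_two_pi_I h2)
      simp only [Function.comp_apply] at h3
      have h4 := congrArg (starRingEnd ℂ) h3
      rwa [Complex.conj_conj, Complex.conj_ofReal] at h4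
  have h1 := h _ (ofReal_re_mem_ecl_empty ha) (hupgrade _ (ofReal_re_mem_ecl_empty ha) hre)
  have h2 := h _ (ofReal_im_mem_ecl_empty ha) (hupgrade _ (ofReal_im_mem_ecl_empty ha) him)
  exact mem_logFreeCore_of_re_im h1 h2

/-- **(i) ⟺ (v)**: the residue stub says exactly that every REAL exponentially algebraic number outside
the log-free core is moved by some core automorphism. -/
theorem coreFixedFieldLogFree_iff_real_moved :
    (∀ a ∈ ecl (∅ : Set ℂ),
      (∀ g : ℂ → ℂ, IsEIsoOn g (ecl (∅ : Set ℂ)) (ecl (∅ : Set ℂ)) → g a = a) →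
        a ∈ (logFreeCore : Set ℂ)) ↔
    ∀ x : ℝ, (x : ℂ) ∈ ecl (∅ : Set ℂ) → (x : ℂ) ∉ logFreeCore →
      ∃ g : ℂ → ℂ, IsEIsoOn g (ecl (∅ : Set ℂ)) (ecl (∅ : Set ℂ)) ∧ g x ≠ x := by
  constructor
  · intro h x hx hnx
    by_contra hall
    push Not at hall
    exact hnx (h _ hx hall)
  · intro h a ha hfix
    obtain ⟨r, rfl⟩ := exists_eq_ofReal_of_forall_isEIsoOn_fixed hfix
    by_contra hna
    obtain ⟨g, hg, hne⟩ := h r ha hna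
    exact hne (hfix g hg)

end Summit.Schanuel.Schanuel.Theorems.AclSubsetLogFreeCore.Negative
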